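import Mathlib
import HarnessLib
import Literature.NumberTheory.Transcendental.KZCalculusProofs
import Summits.KontsevichZagierPeriods.KontsevichZagierPeriods.Theorems.LinRedNormalFormResidualBeyondGenusZeroDimOnePieces

/-!
# Route LinRedNormalForm, item `ResidualBeyondGenusZero` (stmt-KontsevichZagierPeriods-3917): the dimension ladder, import-light (glue-by ready)

Companion of `Theorems/LinRedNormalFormResidualBeyondGenusZeroLadder.lean`. That file proves the
dimension ladder of the declared residual over the NAMED genus-zero generator set `gzSet` (which lives in
a `Negative/` file importing the route file). Here the same ladder is proved GENERICALLY — for an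
arbitrary generator set `G ⊆ FormalRep` in place of the genus-zero set, since the proofs use nothing about
it — and then specialised to the genus-zero set INLINED exactly as in the route declaration, importing
no route file. So the route file can import this one, and the planner can file the next splits of the
ladder with `--glue-by` (the types below are literally `Piece₁ → Piece₂ → Parent` after unfolding) and
cite the `iff`s as their losslessness certificates:

* `residualBeyondGenusZero_of_bottom_and_residualDimOne_inl` /
  `residualBeyondGenusZero_iff_bottom_and_residualDimOne_inl` — RES ⇐ / ↔ Bottom ∧ ResidualBeyondDimOne;
* `residualBeyondDimOne_of_rungOne_and_residualDimTwo_inl` /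
  `residualBeyondDimOne_iff_rungOne_and_residualDimTwo_inl` — ResidualBeyondDimOne ⇐ / ↔ RelKer 1 ∧ Residual 2
  (exact-dimension form of the rung; the `≤ 2` form is `residualBeyondDimOne_of_dimTwoPieces`);
* generic: `exists_forall_mem_relations_sup_closure_union_range` (exhaustion by dimension relative to
  `G`), `residual_iff_ladder`, `residual_succ_iff`, `residualOnto_iff_bottom_and_residual` over any `G`.

Ingredients: soundness `KZ.relations_le_ker_eval_holds`, subgroup algebra (`residual_descend`), and the
slab move `KZ.IntegralRep.exists_equivalent_of_le` (every representation is equivalent to one in each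
higher dimension). References: M. Kontsevich, D. Zagier, *Periods* (2001), §1.2; A. Huber, S. Müller-Stach,
*Periods and Nori Motives* (2017), Conj. 13.2.1.
-/

noncomputable section

namespace Summit.KontsevichZagierPeriods.ResidualBeyondGenusZero.LadderGlue

open Literature.NumberTheory.Transcendental

/-! ## §1 The ladder over an arbitrary generator set `G` -/

variable (G : Set KZ.FormalRep)

/-- For `k ≤ N`, the class of a `k`-dimensional representation lies in the joint sector
`relations ⊔ closure (G ∪ D_N)` (slabs, `KZ.IntegralRep.exists_equivalent_of_le`).
[Kontsevich–Zagier 2001, §1.2, rule (3)] -/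
theorem of_mem_relations_sup_closure_union_range {k N : ℕ} (h : k ≤ N) (r : KZ.IntegralRep k) :
    KZ.of r ∈ KZ.relations ⊔ AddSubgroup.closure (G ∪ Set.range fun s : KZ.IntegralRep N => KZ.of s) := by
  obtain ⟨R, hR⟩ := r.exists_equivalent_of_le h
  rw [AddSubgroup.mem_sup]
  exact ⟨KZ.of r - KZ.of R, hR, KZ.of R, AddSubgroup.subset_closure (Or.inr ⟨R, rfl⟩), by abel⟩

/-- Exhaustion by dimension, relative to `G`: every formal combination lies in the joint sector
`relations ⊔ closure (G ∪ D_N)` for every large `N`. [Kontsevich–Zagier 2001, §1.2] -/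
theorem exists_forall_mem_relations_sup_closure_union_range (c : KZ.FormalRep) :
    ∃ N₀ : ℕ, ∀ N, N₀ ≤ N →
      c ∈ KZ.relations ⊔ AddSubgroup.closure (G ∪ Set.range fun s : KZ.IntegralRep N => KZ.of s) := by
  induction c using FreeAbelianGroup.induction_on with
  | zero => exact ⟨0, fun N _ => zero_mem _⟩
  | of x =>
    obtain ⟨k, r⟩ := x
    exact ⟨k, fun N hN => of_mem_relations_sup_closure_union_range G hN r⟩
  | neg x hx =>
    obtain ⟨N₀, hN₀⟩ := hx
    exact ⟨N₀, fun N hN => neg_mem (hN₀ N hN)⟩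
  | add x y hx hy =>
    obtain ⟨N₁, hN₁⟩ := hx
    obtain ⟨N₂, hN₂⟩ := hy
    exact ⟨max N₁ N₂, fun N hN =>
      add_mem (hN₁ N ((le_max_left _ _).trans hN)) (hN₂ N ((le_max_right _ _).trans hN))⟩

/-- Monotonicity of the joint sectors modulo moves: for `d ≤ d'`,
`closure (G ∪ D_d) ≤ relations ⊔ closure (G ∪ D_{d'})`. [folklore] -/
theorem closure_union_range_le_sup {d d' : ℕ} (h : d ≤ d') :
    AddSubgroup.closure (G ∪ Set.range fun r : KZ.IntegralRep d => KZ.of r) ≤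
      KZ.relations ⊔ AddSubgroup.closure (G ∪ Set.range fun r : KZ.IntegralRep d' => KZ.of r) := by
  rw [AddSubgroup.closure_le]
  rintro x (hx | ⟨r, rfl⟩)
  · exact AddSubgroup.mem_sup_right (AddSubgroup.subset_closure (Or.inl hx))
  · exact of_mem_relations_sup_closure_union_range G h r

/-- Descent along finitely many rungs over `G`. [folklore] -/
theorem residual_descend_iterate (d : ℕ)
    (hL : ∀ d', d ≤ d' →
      ∀ m ∈ AddSubgroup.closure (G ∪ Set.range fun r : KZ.IntegralRep (d' + 1) => KZ.of r), KZ.eval m = 0 →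
        ∃ m' ∈ AddSubgroup.closure (G ∪ Set.range fun r : KZ.IntegralRep d' => KZ.of r), m - m' ∈ KZ.relations) :
    ∀ (j : ℕ) (c : KZ.FormalRep), KZ.eval c = 0 →
      c ∈ KZ.relations ⊔ AddSubgroup.closure (G ∪ Set.range fun r : KZ.IntegralRep (d + j) => KZ.of r) →
      ∃ c' ∈ AddSubgroup.closure (G ∪ Set.range fun r : KZ.IntegralRep d => KZ.of r), c - c' ∈ KZ.relations := by
  intro j
  induction j with
  | zero =>
    intro c _ hmem
    obtain ⟨ρ, hρ, s, hs, rfl⟩ := AddSubgroup.mem_sup.1 hmem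
    exact ⟨s, hs, by simpa using hρ⟩
  | succ j ih =>
    intro c hc hmem
    obtain ⟨ρ, hρ, s, hs, rfl⟩ := AddSubgroup.mem_sup.1 hmem
    have hρ0 : KZ.eval ρ = 0 := (AddMonoidHom.mem_ker).1 (KZ.relations_le_ker_eval_holds hρ)
    have hs0 : KZ.eval s = 0 := by
      rw [map_add, hρ0, zero_add] at hc
      exact hc
    obtain ⟨s', hs', hss'⟩ := hL (d + j) (Nat.le_add_right d j) s hs hs0
    refine ih (ρ + s) hc (AddSubgroup.mem_sup.2 ⟨ρ + (s - s'), add_mem hρ hss', s', hs', ?_⟩)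
    abel

/-- The ladder gives the residual, over `G`. [folklore] -/
theorem residual_of_ladder (d : ℕ)
    (hL : ∀ d', d ≤ d' →
      ∀ m ∈ AddSubgroup.closure (G ∪ Set.range fun r : KZ.IntegralRep (d' + 1) => KZ.of r), KZ.eval m = 0 →
        ∃ m' ∈ AddSubgroup.closure (G ∪ Set.range fun r : KZ.IntegralRep d' => KZ.of r), m - m' ∈ KZ.relations) :
    ∀ c : KZ.FormalRep, KZ.eval c = 0 →
      ∃ c' ∈ AddSubgroup.closure (G ∪ Set.range fun r : KZ.IntegralRep d => KZ.of r), c - c' ∈ KZ.relations := by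
  intro c hc
  obtain ⟨N, hN⟩ := exists_forall_mem_relations_sup_closure_union_range G c
  exact residual_descend_iterate G d hL N c hc (hN (d + N) (Nat.le_add_left N d))

/-- The residual gives the ladder, over `G`. [folklore] -/
theorem ladder_of_residual (d : ℕ)
    (hR : ∀ c : KZ.FormalRep, KZ.eval c = 0 →
      ∃ c' ∈ AddSubgroup.closure (G ∪ Set.range fun r : KZ.IntegralRep d => KZ.of r), c - c' ∈ KZ.relations) :
    ∀ d', d ≤ d' →
      ∀ m ∈ AddSubgroup.closure (G ∪ Set.range fun r : KZ.IntegralRep (d' + 1) => KZ.of r), KZ.eval m = 0 →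
        ∃ m' ∈ AddSubgroup.closure (G ∪ Set.range fun r : KZ.IntegralRep d' => KZ.of r), m - m' ∈ KZ.relations := by
  intro d' hdd' m _ hm0
  obtain ⟨c', hc', hmc'⟩ := hR m hm0
  obtain ⟨ρ, hρ, s, hs, hρs⟩ := AddSubgroup.mem_sup.1 (closure_union_range_le_sup G hdd' hc')
  refine ⟨s, hs, ?_⟩
  have e : m - s = (m - c') + ρ := by rw [← hρs]; abel
  rw [e]
  exact add_mem hmc' hρ

/-- **The ladder theorem over `G`**: `Residual_G d ↔ ∀ d' ≥ d, RelKer_G d'`. [folklore] -/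
theorem residual_iff_ladder (d : ℕ) :
    (∀ c : KZ.FormalRep, KZ.eval c = 0 →
      ∃ c' ∈ AddSubgroup.closure (G ∪ Set.range fun r : KZ.IntegralRep d => KZ.of r), c - c' ∈ KZ.relations) ↔
    ∀ d', d ≤ d' →
      ∀ m ∈ AddSubgroup.closure (G ∪ Set.range fun r : KZ.IntegralRep (d' + 1) => KZ.of r), KZ.eval m = 0 →
        ∃ m' ∈ AddSubgroup.closure (G ∪ Set.range fun r : KZ.IntegralRep d' => KZ.of r), m - m' ∈ KZ.relations :=
  ⟨ladder_of_residual G d, residual_of_ladder G d⟩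

/-- **Peeling one rung over `G`**: `Residual_G d ↔ RelKer_G d ∧ Residual_G (d + 1)`. [folklore] -/
theorem residual_succ_iff (d : ℕ) :
    (∀ c : KZ.FormalRep, KZ.eval c = 0 →
      ∃ c' ∈ AddSubgroup.closure (G ∪ Set.range fun r : KZ.IntegralRep d => KZ.of r), c - c' ∈ KZ.relations) ↔
    (∀ m ∈ AddSubgroup.closure (G ∪ Set.range fun r : KZ.IntegralRep (d + 1) => KZ.of r), KZ.eval m = 0 →
      ∃ m' ∈ AddSubgroup.closure (G ∪ Set.range fun r : KZ.IntegralRep d => KZ.of r), m - m' ∈ KZ.relations) ∧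
    (∀ c : KZ.FormalRep, KZ.eval c = 0 →
      ∃ c' ∈ AddSubgroup.closure (G ∪ Set.range fun r : KZ.IntegralRep (d + 1) => KZ.of r), c - c' ∈ KZ.relations) := by
  constructor
  · intro hR
    refine ⟨ladder_of_residual G d hR d le_rfl, ?_⟩
    exact residual_of_ladder G (d + 1) fun e hde => ladder_of_residual G d hR e ((Nat.le_succ d).trans hde)
  · rintro ⟨hRel, hRes⟩
    exact residual_descend KZ.eval KZ.relations_le_ker_eval_holds hRel hRes

/-- **The residual onto `closure G` is the bottom rung plus the residual beyond dimension one**, over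
`G`: `(∀ c, eval c = 0 → ∃ g ∈ closure G, c - g ∈ relations) ↔ Bottom_G ∧ Residual_G 1`. [folklore] -/
theorem residualOnto_iff_bottom_and_residual :
    (∀ c : KZ.FormalRep, KZ.eval c = 0 → ∃ g ∈ AddSubgroup.closure G, c - g ∈ KZ.relations) ↔
    (∀ m ∈ AddSubgroup.closure (G ∪ Set.range fun r : KZ.IntegralRep 1 => KZ.of r), KZ.eval m = 0 →
      ∃ g ∈ AddSubgroup.closure G, m - g ∈ KZ.relations) ∧
    (∀ c : KZ.FormalRep, KZ.eval c = 0 →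
      ∃ c' ∈ AddSubgroup.closure (G ∪ Set.range fun r : KZ.IntegralRep 1 => KZ.of r), c - c' ∈ KZ.relations) := by
  constructor
  · intro h
    refine ⟨fun m _ hm0 => h m hm0, fun c hc => ?_⟩
    obtain ⟨c₀, hc₀, hcc₀⟩ := h c hc
    exact ⟨c₀, AddSubgroup.closure_mono Set.subset_union_left hc₀, hcc₀⟩
  · rintro ⟨hB, hR⟩
    exact residual_descend KZ.eval KZ.relations_le_ker_eval_holds hB hR

/-! ## §2 Specialisation to the inlined genus-zero set (glue-by ready; no route import) -/

/-- **Glue, split of `ResidualBeyondGenusZero` into the bottom rung and `ResidualBeyondDimOne`**: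
`Bottom → ResidualBeyondDimOne → ResidualBeyondGenusZero`, all three inlined over `Literature`
declarations exactly as in the route file / `SPLIT.md` (so this theorem can be a `--glue-by`).
[folklore] -/
theorem residualBeyondGenusZero_of_bottom_and_residualDimOne_inl
    (hB : ∀ m ∈ AddSubgroup.closure ({x : Literature.NumberTheory.Transcendental.KZ.FormalRep | ∃ (k : ℕ) (r : Literature.NumberTheory.Transcendental.KZ.IntegralRep k) (p : MvPolynomial (Fin k) ℚ) (a : Fin k → Fin k → ℕ) (b c : Fin k → ℕ), r.domain = {t | (∀ i, 0 < t i) ∧ (∀ i, t i < 1) ∧ StrictAnti t} ∧ Set.EqOn r.integrand (fun t => MvPolynomial.aeval t p / ((∏ i, t i ^ b i) * (∏ i, (1 - t i) ^ c i) * ∏ i, ∏ j, if i < j then (t i - t j) ^ a i j else 1)) r.domain ∧ x = Literature.NumberTheory.Transcendental.KZ.of r} ∪ Set.range fun r : Literature.NumberTheory.Transcendental.KZ.IntegralRep 1 => Literature.NumberTheory.Transcendental.KZ.of r), Literature.NumberTheory.Transcendental.KZ.eval m = 0 → ∃ g ∈ AddSubgroup.closure {x : Literature.NumberTheory.Transcendental.KZ.FormalRep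 | ∃ (k : ℕ) (r : Literature.NumberTheory.Transcendental.KZ.IntegralRep k) (p : MvPolynomial (Fin k) ℚ) (a : Fin k → Fin k → ℕ) (b c : Fin k → ℕ), r.domain = {t | (∀ i, 0 < t i) ∧ (∀ i, t i < 1) ∧ StrictAnti t} ∧ Set.EqOn r.integrand (fun t => MvPolynomial.aeval t p / ((∏ i, t i ^ b i) * (∏ i, (1 - t i) ^ c i) * ∏ i, ∏ j, if i < j then (t i - t j) ^ a i j else 1)) r.domain ∧ x = Literature.NumberTheory.Transcendental.KZ.of r}, m - g ∈ Literature.NumberTheory.Transcendental.KZ.relations)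
    (hR : ∀ c : Literature.NumberTheory.Transcendental.KZ.FormalRep, Literature.NumberTheory.Transcendental.KZ.eval c = 0 → ∃ c₁ ∈ AddSubgroup.closure ({x : Literature.NumberTheory.Transcendental.KZ.FormalRep | ∃ (k : ℕ) (r : Literature.NumberTheory.Transcendental.KZ.IntegralRep k) (p : MvPolynomial (Fin k) ℚ) (a : Fin k → Fin k → ℕ) (b c : Fin k → ℕ), r.domain = {t | (∀ i, 0 < t i) ∧ (∀ i, t i < 1) ∧ StrictAnti t} ∧ Set.EqOn r.integrand (fun t => MvPolynomial.aeval t p / ((∏ i, t i ^ b i) * (∏ i, (1 - t i) ^ c i) * ∏ i, ∏ j, if i < j then (t i - t j) ^ a i j else 1)) r.domain ∧ x = Literature.NumberTheory.Transcendental.KZ.of r} ∪ Set.range fun r : Literature.NumberTheory.Transcendental.KZ.IntegralRep 1 => Literature.NumberTheory.Transcendental.KZ.of r), c - c₁ ∈ Literature.NumberTheory.Transcendental.KZ.relations) :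
    ∀ c : Literature.NumberTheory.Transcendental.KZ.FormalRep, Literature.NumberTheory.Transcendental.KZ.eval c = 0 → ∃ c₀ ∈ AddSubgroup.closure {x : Literature.NumberTheory.Transcendental.KZ.FormalRep | ∃ (k : ℕ) (r : Literature.NumberTheory.Transcendental.KZ.IntegralRep k) (p : MvPolynomial (Fin k) ℚ) (a : Fin k → Fin k → ℕ) (b c : Fin k → ℕ), r.domain = {t | (∀ i, 0 < t i) ∧ (∀ i, t i < 1) ∧ StrictAnti t} ∧ Set.EqOn r.integrand (fun t => MvPolynomial.aeval t p / ((∏ i, t i ^ b i) * (∏ i, (1 - t i) ^ c i) * ∏ i, ∏ j, if i < j then (t i - t j) ^ a i j else 1)) r.domain ∧ x = Literature.NumberTheory.Transcendental.KZ.of r}, c - c₀ ∈ Literature.NumberTheory.Transcendental.KZ.relations :=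
  (residualOnto_iff_bottom_and_residual _).2 ⟨hB, hR⟩

/-- **Losslessness certificate of that split**: `ResidualBeyondGenusZero ↔ Bottom ∧ ResidualBeyondDimOne`
(inlined). [folklore] -/
theorem residualBeyondGenusZero_iff_bottom_and_residualDimOne_inl :
    (∀ c : Literature.NumberTheory.Transcendental.KZ.FormalRep, Literature.NumberTheory.Transcendental.KZ.eval c = 0 → ∃ c₀ ∈ AddSubgroup.closure {x : Literature.NumberTheory.Transcendental.KZ.FormalRep | ∃ (k : ℕ) (r : Literature.NumberTheory.Transcendental.KZ.IntegralRep k) (p : MvPolynomial (Fin k) ℚ) (a : Fin k → Fin k → ℕ) (b c : Fin k → ℕ), r.domain = {t | (∀ i, 0 < t i) ∧ (∀ i, t i < 1) ∧ StrictAnti t} ∧ Set.EqOn r.integrand (fun t => MvPolynomial.aeval t p / ((∏ i, t i ^ b i) * (∏ i, (1 - t i) ^ c i) * ∏ i, ∏ j, if i < j then (t i - t j) ^ a i j else 1)) r.domain ∧ x = Literature.NumberTheory.Transcendental.KZ.of r}, c - c₀ ∈ Literature.NumberTheory.Transcendental.KZ.relations) ↔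
    (∀ m ∈ AddSubgroup.closure ({x : Literature.NumberTheory.Transcendental.KZ.FormalRep | ∃ (k : ℕ) (r : Literature.NumberTheory.Transcendental.KZ.IntegralRep k) (p : MvPolynomial (Fin k) ℚ) (a : Fin k → Fin k → ℕ) (b c : Fin k → ℕ), r.domain = {t | (∀ i, 0 < t i) ∧ (∀ i, t i < 1) ∧ StrictAnti t} ∧ Set.EqOn r.integrand (fun t => MvPolynomial.aeval t p / ((∏ i, t i ^ b i) * (∏ i, (1 - t i) ^ c i) * ∏ i, ∏ j, if i < j then (t i - t j) ^ a i j else 1)) r.domain ∧ x = Literature.NumberTheory.Transcendental.KZ.of r} ∪ Set.range fun r : Literature.NumberTheory.Transcendental.KZ.IntegralRep 1 => Literature.NumberTheory.Transcendental.KZ.of r), Literature.NumberTheory.Transcendental.KZ.eval m = 0 → ∃ g ∈ AddSubgroup.closure {x : Literature.NumberTheory.Transcendental.KZ.FormalRep | ∃ (k : ℕ) (r : Literature.NumberTheory.Transcendental.KZ.IntegralRep k) (p : MvPolynomial (Fin k) ℚ) (a : Fin k → Fin k → ℕ) (b c : Fin k → ℕ), r.domain = {t | (∀ i, 0 < t i)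 ∧ (∀ i, t i < 1) ∧ StrictAnti t} ∧ Set.EqOn r.integrand (fun t => MvPolynomial.aeval t p / ((∏ i, t i ^ b i) * (∏ i, (1 - t i) ^ c i) * ∏ i, ∏ j, if i < j then (t i - t j) ^ a i j else 1)) r.domain ∧ x = Literature.NumberTheory.Transcendental.KZ.of r}, m - g ∈ Literature.NumberTheory.Transcendental.KZ.relations) ∧
    (∀ c : Literature.NumberTheory.Transcendental.KZ.FormalRep, Literature.NumberTheory.Transcendental.KZ.eval c = 0 → ∃ c₁ ∈ AddSubgroup.closure ({x : Literature.NumberTheory.Transcendental.KZ.FormalRep | ∃ (k : ℕ) (r : Literature.NumberTheory.Transcendental.KZ.IntegralRep k) (p : MvPolynomial (Fin k) ℚ) (a : Fin k → Fin k → ℕ) (b c : Fin k → ℕ), r.domain = {t | (∀ i, 0 < t i) ∧ (∀ i, t i < 1) ∧ StrictAnti t} ∧ Set.EqOn r.integrand (fun t => MvPolynomial.aeval t p / ((∏ i, t i ^ b i) * (∏ i, (1 - t i) ^ c i) * ∏ i, ∏ j, if i < j then (t i - t j) ^ a i j else 1)) r.domain ∧ x = Literature.NumberTheory.Transcendental.KZ.of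 r} ∪ Set.range fun r : Literature.NumberTheory.Transcendental.KZ.IntegralRep 1 => Literature.NumberTheory.Transcendental.KZ.of r), c - c₁ ∈ Literature.NumberTheory.Transcendental.KZ.relations) :=
  residualOnto_iff_bottom_and_residual _

/-- **Glue, first split down the ladder**: `RelKer 1 → Residual 2 → ResidualBeyondDimOne` (inlined;
exact-dimension form — a vanishing `ℤ`-combination of genus-zero and two-dimensional representations
reduces modulo moves to genus-zero and one-dimensional ones; every vanishing formal combination reduces
to genus-zero and two-dimensional ones). [folklore] -/
theorem residualBeyondDimOne_of_rungOne_and_residualDimTwo_inl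
    (hRel : ∀ m ∈ AddSubgroup.closure ({x : Literature.NumberTheory.Transcendental.KZ.FormalRep | ∃ (k : ℕ) (r : Literature.NumberTheory.Transcendental.KZ.IntegralRep k) (p : MvPolynomial (Fin k) ℚ) (a : Fin k → Fin k → ℕ) (b c : Fin k → ℕ), r.domain = {t | (∀ i, 0 < t i) ∧ (∀ i, t i < 1) ∧ StrictAnti t} ∧ Set.EqOn r.integrand (fun t => MvPolynomial.aeval t p / ((∏ i, t i ^ b i) * (∏ i, (1 - t i) ^ c i) * ∏ i, ∏ j, if i < j then (t i - t j) ^ a i j else 1)) r.domain ∧ x = Literature.NumberTheory.Transcendental.KZ.of r} ∪ Set.range fun r : Literature.NumberTheory.Transcendental.KZ.IntegralRep 2 => Literature.NumberTheory.Transcendental.KZ.of r), Literature.NumberTheory.Transcendental.KZ.eval m = 0 → ∃ m' ∈ AddSubgroup.closure ({x : Literature.NumberTheory.Transcendental.KZ.FormalRep | ∃ (k : ℕ) (r : Literature.NumberTheory.Transcendental.KZ.IntegralRep k) (p : MvPolynomial (Fin k) ℚ) (a : Fin k → Fin k → ℕ) (b c : Fin k → ℕ), r.domain = {t | (∀ i,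 0 < t i) ∧ (∀ i, t i < 1) ∧ StrictAnti t} ∧ Set.EqOn r.integrand (fun t => MvPolynomial.aeval t p / ((∏ i, t i ^ b i) * (∏ i, (1 - t i) ^ c i) * ∏ i, ∏ j, if i < j then (t i - t j) ^ a i j else 1)) r.domain ∧ x = Literature.NumberTheory.Transcendental.KZ.of r} ∪ Set.range fun r : Literature.NumberTheory.Transcendental.KZ.IntegralRep 1 => Literature.NumberTheory.Transcendental.KZ.of r), m - m' ∈ Literature.NumberTheory.Transcendental.KZ.relations)
    (hRes : ∀ c : Literature.NumberTheory.Transcendental.KZ.FormalRep, Literature.NumberTheory.Transcendental.KZ.eval c = 0 → ∃ c₂ ∈ AddSubgroup.closure ({x : Literature.NumberTheory.Transcendental.KZ.FormalRep | ∃ (k : ℕ) (r : Literature.NumberTheory.Transcendental.KZ.IntegralRep k) (p : MvPolynomial (Fin k) ℚ) (a : Fin k → Fin k → ℕ) (b c : Fin k → ℕ), r.domain = {t | (∀ i, 0 < t i) ∧ (∀ i, t i < 1) ∧ StrictAnti t} ∧ Set.EqOn r.integrand (fun t => MvPolynomial.aeval t p / ((∏ i, t i ^ b i) * (∏ i, (1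 - t i) ^ c i) * ∏ i, ∏ j, if i < j then (t i - t j) ^ a i j else 1)) r.domain ∧ x = Literature.NumberTheory.Transcendental.KZ.of r} ∪ Set.range fun r : Literature.NumberTheory.Transcendental.KZ.IntegralRep 2 => Literature.NumberTheory.Transcendental.KZ.of r), c - c₂ ∈ Literature.NumberTheory.Transcendental.KZ.relations) :
    ∀ c : Literature.NumberTheory.Transcendental.KZ.FormalRep, Literature.NumberTheory.Transcendental.KZ.eval c = 0 → ∃ c₁ ∈ AddSubgroup.closure ({x : Literature.NumberTheory.Transcendental.KZ.FormalRep | ∃ (k : ℕ) (r : Literature.NumberTheory.Transcendental.KZ.IntegralRep k) (p : MvPolynomial (Fin k) ℚ) (a : Fin k → Fin k → ℕ) (b c : Fin k → ℕ), r.domain = {t | (∀ i, 0 < t i) ∧ (∀ i, t i < 1) ∧ StrictAnti t} ∧ Set.EqOn r.integrand (fun t => MvPolynomial.aeval t p / ((∏ i, t i ^ b i) * (∏ i, (1 - t i) ^ c i) * ∏ i, ∏ j, if i < j then (t i - t j) ^ a i j else 1)) r.domain ∧ x = Literature.NumberTheory.Transcendental.KZ.of r} ∪ Set.range fun r : Literature.NumberTheory.Transcendental.KZ.IntegralRep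 1 => Literature.NumberTheory.Transcendental.KZ.of r), c - c₁ ∈ Literature.NumberTheory.Transcendental.KZ.relations :=
  (residual_succ_iff _ 1).2 ⟨hRel, hRes⟩

/-- **Losslessness certificate of the first split down the ladder**:
`ResidualBeyondDimOne ↔ RelKer 1 ∧ Residual 2` (inlined). [folklore] -/
theorem residualBeyondDimOne_iff_rungOne_and_residualDimTwo_inl :
    (∀ c : Literature.NumberTheory.Transcendental.KZ.FormalRep, Literature.NumberTheory.Transcendental.KZ.eval c = 0 → ∃ c₁ ∈ AddSubgroup.closure ({x : Literature.NumberTheory.Transcendental.KZ.FormalRep | ∃ (k : ℕ) (r : Literature.NumberTheory.Transcendental.KZ.IntegralRep k) (p : MvPolynomial (Fin k) ℚ) (a : Fin k → Fin k → ℕ) (b c : Fin k → ℕ), r.domain = {t | (∀ i, 0 < t i) ∧ (∀ i, t i < 1) ∧ StrictAnti t} ∧ Set.EqOn r.integrand (fun t => MvPolynomial.aeval t p / ((∏ i, t i ^ b i) * (∏ i, (1 - t i) ^ c i) * ∏ i, ∏ j, if i < j then (t i - t j) ^ a i j else 1)) r.domain ∧ x = Literature.NumberTheory.Transcendental.KZ.of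 r} ∪ Set.range fun r : Literature.NumberTheory.Transcendental.KZ.IntegralRep 1 => Literature.NumberTheory.Transcendental.KZ.of r), c - c₁ ∈ Literature.NumberTheory.Transcendental.KZ.relations) ↔
    (∀ m ∈ AddSubgroup.closure ({x : Literature.NumberTheory.Transcendental.KZ.FormalRep | ∃ (k : ℕ) (r : Literature.NumberTheory.Transcendental.KZ.IntegralRep k) (p : MvPolynomial (Fin k) ℚ) (a : Fin k → Fin k → ℕ) (b c : Fin k → ℕ), r.domain = {t | (∀ i, 0 < t i) ∧ (∀ i, t i < 1) ∧ StrictAnti t} ∧ Set.EqOn r.integrand (fun t => MvPolynomial.aeval t p / ((∏ i, t i ^ b i) * (∏ i, (1 - t i) ^ c i) * ∏ i, ∏ j, if i < j then (t i - t j) ^ a i j else 1)) r.domain ∧ x = Literature.NumberTheory.Transcendental.KZ.of r} ∪ Set.range fun r : Literature.NumberTheory.Transcendental.KZ.IntegralRep 2 => Literature.NumberTheory.Transcendental.KZ.of r), Literature.NumberTheory.Transcendental.KZ.eval m = 0 → ∃ m' ∈ AddSubgroup.closure ({x : Literature.NumberTheory.Transcendental.KZ.FormalRep | ∃ (k : ℕ)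 (r : Literature.NumberTheory.Transcendental.KZ.IntegralRep k) (p : MvPolynomial (Fin k) ℚ) (a : Fin k → Fin k → ℕ) (b c : Fin k → ℕ), r.domain = {t | (∀ i, 0 < t i) ∧ (∀ i, t i < 1) ∧ StrictAnti t} ∧ Set.EqOn r.integrand (fun t => MvPolynomial.aeval t p / ((∏ i, t i ^ b i) * (∏ i, (1 - t i) ^ c i) * ∏ i, ∏ j, if i < j then (t i - t j) ^ a i j else 1)) r.domain ∧ x = Literature.NumberTheory.Transcendental.KZ.of r} ∪ Set.range fun r : Literature.NumberTheory.Transcendental.KZ.IntegralRep 1 => Literature.NumberTheory.Transcendental.KZ.of r), m - m' ∈ Literature.NumberTheory.Transcendental.KZ.relations) ∧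
    (∀ c : Literature.NumberTheory.Transcendental.KZ.FormalRep, Literature.NumberTheory.Transcendental.KZ.eval c = 0 → ∃ c₂ ∈ AddSubgroup.closure ({x : Literature.NumberTheory.Transcendental.KZ.FormalRep | ∃ (k : ℕ) (r : Literature.NumberTheory.Transcendental.KZ.IntegralRep k) (p : MvPolynomial (Fin k) ℚ) (a : Fin k → Fin k → ℕ) (b c : Fin k → ℕ), r.domain = {t | (∀ i, 0 < t i) ∧ (∀ i, t i < 1) ∧ StrictAnti t} ∧ Set.EqOn r.integrand (fun t => MvPolynomial.aeval t p / ((∏ i, t i ^ b i) * (∏ i, (1 - t i) ^ c i) * ∏ i, ∏ j, if i < j then (t i - t j) ^ a i j else 1)) r.domain ∧ x = Literature.NumberTheory.Transcendental.KZ.of r} ∪ Set.range fun r : Literature.NumberTheory.Transcendental.KZ.IntegralRep 2 => Literature.NumberTheory.Transcendental.KZ.of r), c - c₂ ∈ Literature.NumberTheory.Transcendental.KZ.relations) :=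
  residual_succ_iff _ 1

end Summit.KontsevichZagierPeriods.ResidualBeyondGenusZero.LadderGlue

end
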